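import Mathlib
import HarnessLib
import HarnessLib.Audit
import Summits.AtomisticToContinuum.Statement
import Literature.MathematicalPhysics.KineticTheory.LangevinChainNESS
import Summits.AtomisticToContinuum.FouriersLaw.Theorems.EmbeddedDrudeMourreNessUnique
import Summits.AtomisticToContinuum.FouriersLaw.Theorems.FourierGreenKuboFourierFiniteResponseOfUnique

/-!
Route: NoiseHomotopyTransfer

CLOSED (retired) 2026-08-15T13:44:58Z by operator:999:1257524 — reason: not-a-thesis: assembly does not conclude the sub-problem Statement — note: D-0027 §2.1 audit (human 2026-08-15: routes that do not decide the summit are removed): the assembly concludes `Literature.MathematicalPhysics.KineticTheory.HeatConduction.FouriersLaw`, not the sub-problem statement; a NEW conforming route may be opened from the same idea (generated `closes : … → _r. The file is kept as the record of this route; refuted decls are indexed as negative knowledge (`ledger negatives`).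

# Route NoiseHomotopyTransfer — noise homotopy — an N-uniform modulus of continuity of the
open-chain resistivity in added velocity-flip noise transfers noisy Fourier to ε = 0; finiteness =
one ε-uniform bound at positive noise

Realises card AtomisticToContinuum/FouriersLaw/noise-homotopy-russo-transfer (graded
new-combination). Embed the conjunct's chain in the one-parameter family L_ε = L + εS, S =
independent velocity flips p_i ↦ −p_i at every site (energy-conserving bulk noise, BernardinOlla2011
§2.1), and let D_N(ε) be the BLR response coefficient of the noisy N-chain between the same Langevin
baths (D_N(0) is the conjunct's). It suffices to show X = X1 ∧ X2 ∧ X3: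
X1 NoiseLocality — the bond resistivity 1/D_N(ε) is equicontinuous at ε = 0⁺ UNIFORMLY IN N (a
modulus w(ε) → 0 with |1/D_N(ε) − 1/D_N(0)| ≤ w(ε), filed division-free); expected w = C(T)ε from a
Russo-type sitewise derivative formula with a locality bound;
X2 VanishingNoiseBound — the noisy conductivities κ_ε(T) = lim_N D_N(ε) stay bounded as ε ↓ 0
(equivalently, given X1 and X3: ONE strict inequality 1/κ_ε₀ > w(ε₀) at ONE positive noise level);
X3 NoisyFourier — Fourier's law in BLR form (both clauses of FouriersLawFor) for the noisy chain at
every ε > 0.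
Then 1/D_N(0) is Cauchy (limsup − liminf ≤ 2w(ε) for every ε), converges to r₀ = lim_ε 1/κ_ε, r₀ ≥
1/K > 0, and D_N(0) → 1/r₀ ∈ (0,∞): clause (ii); clause (i) from the landed fact
CuneoEckmannHairerReyBellet2018_pinnedChain + the shared support NessUnique; D_N(0) exists by the
shared support FiniteResponseOfUnique. No exchange of the limits ε → 0, N → ∞ is performed anywhere.
Lean: `Summit.AtomisticToContinuum.FouriersLaw.Theses.NoiseHomotopyTransfer.NoiseLocality ∧
Summit.AtomisticToContinuum.FouriersLaw.Theses.NoiseHomotopyTransfer.VanishingNoiseBound ∧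
Summit.AtomisticToContinuum.FouriersLaw.Theses.NoiseHomotopyTransfer.NoisyFourier   (with the shared
supports Summit.AtomisticToContinuum.FouriersLaw.Theses.NoiseHomotopyTransfer.NessUnique ∧
Summit.AtomisticToContinuum.FouriersLaw.Theses.NoiseHomotopyTransfer.FiniteResponseOfUnique and the
landed fact
Literature.MathematicalPhysics.KineticTheory.HeatConduction.CuneoEckmannHairerReyBellet2018_pinnedChain;
Assembly : fact → NessUnique → FiniteResponseOfUnique → NoiseLocality → VanishingNoiseBound →
NoisyFourier → Literature.MathematicalPhysics.KineticTheory.HeatConduction.FouriersLaw)`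

## Assembly
Pure real analysis plus bookkeeping once the five hypotheses are in hand (see the item text):
uniqueness makes D_N(0) canonical, NoisyFourier + VanishingNoiseBound give noisy resistivity limits
1/κ_ε ≥ 1/K, NoiseLocality squeezes 1/D_N(0) between 1/κ_ε ∓ w(ε) eventually in N, hence 1/D_N(0) →
r₀ ≥ 1/K > 0 and D_N(0) → 1/r₀; then the proved frame
Literature.HeatConduction.fouriersLaw_of_steadyState_and_linearResponse.

Rationale: WHY THIS LINE. The one setting in which the heat-conduction programme WORKS is the chain with
energy-conserving bulk noise (BernardinOlla2005, BernardinOlla2011, OllaSasada2012, Bernardin2014),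
and the catalogued barrier HasBoundedResponse records exactly that this evasion 'does not reach the
deterministic chain'; the vanishing-noise question is posed in
BernardinHuveneersLebowitzLiveraniOlla2015 §1 and attacked there only by formal expansions at fixed
noise. This line supplies the missing transfer as a one-line real-analysis device: an N-UNIFORM
modulus of continuity of the finite-N open-chain resistivity in the noise strength (X1) commutes
with N → ∞ by itself, so noisy Fourier (X3, stochastic technology: KLO/Sethuraman variational
formulas, non-gradient two-block estimates, entropy production — imported from
interacting-particle-systems probability, KipnisLandim1999) passes to ε = 0 without exchanging
limits, existence and positivity of κ(0) come for free, and the entire anti-ballistic difficulty is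
relocated to X2, an ε-uniform bound on conductivities of NOISY chains, where variational calculus is
available and which, once the modulus is explicit, is a single strict test-function inequality at
one positive ε₀. No physical analogy is used beyond the Matthiessen/Kohler heuristic 'resistivities
of independent scatterers add' (Soto 2016 §8.6.5), which motivates X1–X2 but is not load-bearing.
Versus the only other route of the sub (FourierGreenKubo: C_T ∈ L¹ for the infinite deterministic
chain + thermodynamic limit): here the deterministic chain is never studied in infinite volume and
no Green–Kubo object at ε = 0 appears; the two routes share only the print-level supports NessUnique
/ FiniteResponseOfUnique. Versus the sibling card parity-split-noise-derivative (graded variant; not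
routed at filing): that card SIGNS ∂_εD_N by a parity identity; this route only needs a modulus and
is agnostic to sign. Negatives index: empty at filing.

RANKED CRUXES. #2 NoiseLocality (crux) — NOISE LOCALITY (card noise-homotopy-russo-transfer item 2,
filed in modulus form). Noisy chain := pinnedChain ω₂ lam β γ between the same Langevin baths PLUS
independent velocity flips p_i ↦ −p_i at every site at rate ε (generator L + εS, S f = Σ_i (f∘Θ_i −
f), BernardinOlla2011 §2.1); weak noisy steady state := probability measure with ∫ (L f + ε S f) dμ
= 0 for f ∈ C_c^∞ and integrable bond currents (the flips carry no energy current, so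
bondCurrent/totalCurrent are the deterministic ones; at ε = 0 this is IsSteadyState verbatim). In
every statement this predicate is bound once as S with a defining equation (∀ S, S = (fun ε N T_L
T_R μ ↦ …) → …). CLAIM: for all parameters > 0 and T > 0 there is a modulus w with w(ε) → 0 as ε ↓
0, UNIFORM IN N, such that for every N, every ε ∈ (0,1], the unique deterministic steady-state
family μ⁰ and the unique noisy family μ^ε at this N, and their response coefficients D⁰ = lim_{δ→0}
totalCurrent(μ⁰_{T+δ/2,T−δ/2})/δ, D^ε (same for μ^ε): |D⁰ − D^ε| ≤ w(ε)·|D⁰|·|D^ε| — division-free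
form of |1/D_N(ε) − 1/D_N(0)| ≤ w(ε) for the bond resistivities r_N = 1/D_N. Expected proof output:
w(ε) = C(T)·ε from a Russo-type derivative formula ∂_ε r_N = Σ_x ∂r_N/∂ε_x (fixed-N smooth
perturbation theory of the hypoelliptic generator by the bounded flip kernels, HairerMajda2009) with
the sitewise LOCALITY bound |∂r_N/∂ε_x| ≤ C/(N−1) ('one extra scatterer changes the total resistance
(N−1)·r_N by O(1)'); a heavy equilibrium current-autocorrelation tail would only degrade the modulus
(heuristically r(ε) − r(0) ≍ ∫ C_T(t)(1 − e^{−2εt}) dt, so a t^{−3/2} tail gives √ε), which this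
form tolerates. Holds in the ballistic harmonic corner (r_N(0) → 0, r_N(ε) ≈ cε: w = cε;
BernardinOlla2011 Thm 3), fails under localisation (disordered pinning, r_N(0) ~ e^{cN}:
BernardinHuveneers2013). Together with NoisyFourier it forces 1/D_N(0) → r₀ := lim_{ε↓0} 1/κ_ε ∈
[0,∞): existence of the limit and κ(0) = 1/r₀ ∈ (0,∞] come for free; finiteness is
VanishingNoiseBound. No exchange of the limits ε → 0, N → ∞ is ever performed. [difficulty: XL] (why
it might fail: N-uniform equicontinuity at ε=0 carries the 'limit exists' half of Fourier's law:
false if D_N(0) oscillates in N while each D_N(ε) converges; the sitewise response is a space-time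
NESS correlation with no N-uniform bound in print (breathers, near-integrable low-T phonons); false
if localised.) [BernardinOlla2011 (arXiv:1105.0493) §2.1 and Thm 3,
BernardinHuveneersLebowitzLiveraniOlla2015 (doi:10.1007/s00220-014-2206-7) §1, HairerMajda2009
(arXiv:0909.4313) Thm 2.3, BernardinHuveneers2013, Spohn2014 (arXiv:1305.6412) §1-2 (current tails
by mode coupling), LepriLiviPoliti2003 §5-6, decl
Literature.Barriers.AtomisticToContinuum.AjankiHuveneers2011_scaling]
#3 VanishingNoiseBound (crux) — VANISHING-NOISE BOUND (card item 4 'StrictNoisyBound' in closed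
form; S = the flip-noisy steady-state predicate of NoiseLocality). CLAIM: for all parameters > 0 and
T > 0 there are K and ε₁ > 0 such that for every ε ∈ (0, ε₁], the unique noisy steady-state family
at rate ε, every sequence D_N(ε) of its response coefficients at T and every limit k = lim_N D_N(ε):
k ≤ K — the noisy conductivities κ_ε(T) stay bounded as the noise vanishes. This is where κ(0) < ∞
lives: given NoiseLocality (modulus w) and NoisyFourier one has |r₀ − 1/κ_ε| ≤ w(ε), so
VanishingNoiseBound ⇔ r₀ > 0 ⇔ there is ONE ε₀ ∈ (0,1] with 1/κ_{ε₀}(T) > w(ε₀) — the card's 'single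
strict inequality at positive noise'. Operational form once w is explicit (foreseen split): certify
κ_{ε₀}(T) < 1/w(ε₀) at one noise level by the Kipnis–Landim–Olla / Sethuraman inf-variational
formula for the NOISY chain, where the symmetric part εS is a bounded non-degenerate-in-momenta
Dirichlet form (BernardinOlla2011 eq. (var); their Prop 4 takes f = −V(r₁)/2 and gets only κ_ε ≤
Var(V′)/(4εT), i.e. ON the harmonic line c/ε — one must beat 1/ε once, with a test function that
encodes anharmonic scattering; the Gibbs integrals are 1-D transfer-operator quantities). Fails, as
it must, for the harmonic chain (κ_ε = c/ε, HarmonicChainBallisticFlux) and for any chain with a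
flip-non-invariant hidden conserved quantity (Mazur: κ_ε ≳ 1/ε); with NoiseLocality it implies
HasBoundedResponse for pinnedChain. [difficulty: open-problem] (why it might fail: It is ε-uniform
control of the noise-regularised conductivity as noise→0 (BHLLO2015's open question): every printed
variational bound is O(1/ε) (BO2011 Prop 4); beating 1/ε needs an approximate deterministic
corrector, possibly GreenKubo-hard; false if pinnedChain is anomalous or has a hidden charge)
[BernardinOlla2011 (arXiv:1105.0493) Thm 2 and Prop 4 eq. (var),
BernardinHuveneersLebowitzLiveraniOlla2015 §1, Bernardin2014 (arXiv:1407.7023) §2.1.3,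
KipnisLandim1999 (variational formulas), BonettoLebowitzReyBellet2000 §6.3, decl
Literature.Barriers.AtomisticToContinuum.HasBoundedResponse, decl
Literature.Barriers.AtomisticToContinuum.Mazur1969_inequality, decl
Literature.Barriers.AtomisticToContinuum.HarmonicChainBallisticFlux]
#4 NoisyFourier (crux) — NOISY FOURIER LAW (card item 3; S = the flip-noisy steady-state predicate
of NoiseLocality). CLAIM: for all parameters > 0 and EVERY flip rate ε > 0,
OscillatorChain.FouriersLawFor verbatim for the noisy chain: (i) for all N and T_L, T_R > 0 the weak
steady state of L + εS exists and is unique; (ii) there is κ_ε : ℝ → ℝ with κ_ε(T) > 0 for T > 0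
such that for every noisy steady-state family and every T > 0 the response limits D_N(ε) = lim_{δ→0,
δ≠0} totalCurrent(μ_{N,T+δ/2,T−δ/2})/δ exist for all N and D_N(ε) → κ_ε(T). Print: NESS existence
and uniqueness for anharmonic chain + flips + Langevin baths (BernardinOlla2011 Prop 1, unpinned
with tension; for the pinned chain: CEHR2018 Lyapunov/Harris machinery plus a bounded jump
perturbation, and Echeverría-type identification of weak solutions of the jump-diffusion
Fokker–Planck equation); Green–Kubo limit exists with flips (BernardinOlla2011 Thm 2) with two-sided
bounds (Props 4–8); Fourier's law IN THE NESS only for the harmonic bulk (BernardinOlla2011 Thm 3;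
BernardinOlla2005 for the exchange noise); diffusive hydrodynamic limit for anharmonic +
conservative noise by the non-gradient method for bounded-Hessian potentials (OllaSasada2012). The
boundary-driven anharmonic statement D_N(ε) → κ_ε is NOT in print ('we are not able to prove the
same for J_s', BernardinOlla2011 p.3): the tools (ε-spectral gap of S in the momenta,
entropy-production bounds, two-block/non-gradient estimates, O(1) boundary layers absorbed by
totalCurrent = (N−1)·J̃) exist, the theorem does not. Needed by the assembly only for ε ≤ min(ε₁,
1), stated for all ε > 0 (larger noise is not harder). [difficulty: XL] (why it might fail: Even
with flips, D_N(ε)→κ_ε for the boundary-driven ANHARMONIC chain is unproved (BO2011 p.3 'not able to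
prove'); non-gradient/macro-ergodicity theorems need bounded U″,V″ (FFL) and the quartic pinnedChain
is outside that scope (pinnedChain_outside_FFL_scope); bath boundary layers.) [BernardinOlla2011
(arXiv:1105.0493) Prop 1 / Thm 2 / Thm 3 / p.3, BernardinOlla2005, OllaSasada2012
(doi:10.1007/s00440-012-0469-5), Bernardin2014 (arXiv:1407.7023) Thm 3,
CuneoEckmannHairerReyBellet2018 Thm 2.13, decl
Literature.Barriers.AtomisticToContinuum.MacroErgodicityBarrier, decl
Literature.Barriers.AtomisticToContinuum.HeatConduction.pinnedChain_outside_FFL_scope]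
#9 NessUnique (support) — UNIQUENESS OF THE WEAK STEADY STATE — shared verbatim with route
FourierGreenKubo (stmt-AtomisticToContinuum-0741): for pinnedChain ω₂ lam β γ (all > 0), every N and
T_L, T_R > 0, any two measures in the class IsSteadyState coincide (CuneoEckmannHairerReyBellet2018
Thm 2.13(1) uniqueness of the invariant measure + identification of weak stationary Fokker–Planck
solutions with invariant measures, Echeverría 1982 / Ethier–Kurtz Thm 4.9.17 + non-explosion via
e^{θH}). The existence half is the LANDED fact CuneoEckmannHairerReyBellet2018_pinnedChain (proved:
LangevinChainNESSHolds). Hypothesis of FiniteResponseOfUnique and source of the deterministic family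
in NoiseLocality; gives clause (i). [difficulty: L] [CuneoEckmannHairerReyBellet2018 Thm 2.13, decl
Literature.MathematicalPhysics.KineticTheory.HeatConduction.CuneoEckmannHairerReyBellet2018_pinnedChain]
#9 FiniteResponseOfUnique (support) — FINITE-N LINEAR RESPONSE EXISTS, GIVEN UNIQUENESS — shared
verbatim with route FourierGreenKubo (stmt-AtomisticToContinuum-0717): under NessUnique, for every
steady-state family, T > 0 and N the limit D_N(T) = lim_{δ→0, δ≠0} totalCurrent(μ_{N,T+δ/2,T−δ/2})/δ
exists (differentiability at equilibrium of NESS expectations of the polynomial currents in the bath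
temperatures: HairerMajda2009 arXiv:0909.4313 framework, ReyBellet2003 Rem 4.4 finite-volume
Green–Kubo; CEHR2018 Lyapunov structure). Supplies D_N(0) to the transfer. N = 0, 1: totalCurrent ≡
0, D = 0. [deps: NessUnique] [difficulty: L] [HairerMajda2009 (arXiv:0909.4313), ReyBellet2003 Rem
4.4, CuneoEckmannHairerReyBellet2018]

TWO-LAYER PLAN. Foreseen glued splits (nothing filed now; k ≤ 3, depth 1): (a) VanishingNoiseBound ⇐
ExplicitModulus (NoiseLocality with an explicit w, e.g. w(ε) = C(T)ε with C(T) a certified number at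
the temperatures of interest) → OneNoiseWitness (at one ε₀: a KLO inf-formula test-function bound
κ_{ε₀}(T) < 1/w(ε₀), Gibbs integrals certified via the 1-D transfer operator) → NoisyFourier
restricted to ε₀ → VanishingNoiseBound. (b) NoiseLocality ⇐ RussoFormula (fixed N: ε ↦ D_N(ε) is C¹
on [0,1] with ∂_ε(1/D_N) = Σ_x sitewise responses, each an explicit NESS expectation against the
linear-response density) → SitewiseLocality (|∂(1/D_N)/∂ε_x| ≤ C(T)/(N−1) uniformly in N, x, ε) →
NoiseLocality with w = Cε. (c) NoisyFourier ⇐ NoisyNessExistsUnique (clause (i), print-level) →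
NoisyResponseConverges (clause (ii)) → NoisyFourier.

KILL CRITERIA. Refutation of NoiseLocality for pinnedChain (e.g. a proof that 1/D_N(ε) − 1/D_N(0) is
not equicontinuous in N, or numerics showing (N−1)·∂r_N/∂ε_x growing with N at T = 1) closes the
route (close --reason refuted:NoiseLocality): the transfer device is the route. Refutation of
VanishingNoiseBound (κ_ε(T) → ∞ as ε ↓ 0, e.g. from a flip-non-invariant hidden conserved quantity
via Mazur, or anomalous transport of the pinned chain) refutes, together with NoiseLocality +
NoisyFourier, clause (ii) of the conjunct itself → file ¬FouriersLaw and close. Refutation of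
NoisyFourier at some ε > 0 (e.g. non-uniqueness of noisy weak steady states, or a flip-INVARIANT
hidden charge making κ_ε infinite) forces a pivot to a different conservative noise
(momentum-exchange noise S′ of BernardinOlla2005/2011 Prop 5) via --restate, not a close. If
FourierGreenKubo's GreenKubo + ThermodynamicLimit land first, this route is moot (superseded).

NOT DECOMPOSED YET. Deliberately NOT filed at open: the Russo/derivative formula and the sitewise
locality constant (children of NoiseLocality, plan (b)); the explicit modulus and the one-ε₀
test-function certificate (children of VanishingNoiseBound, plan (a)) — they need w explicit first;
the split of NoisyFourier into NESS existence/uniqueness and response convergence (plan (c)); any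
T-dependence or uniformity of w, K, ε₁ (none is claimed: all constants depend on T, consistent with
the low-temperature harmonic corner); a Literature definition of the flip-noisy chain (requested
below) — the statements inline it, so nothing waits on it; a Target item (X is the conjunction of
the three cruxes; a rank-0 restatement would duplicate 6 kB of terms and carry no staffing).

CHEAPEST FALSIFIER. (1) Harmonic test bed (lam = β = 0, outside the conjunct but everything
Gaussian/explicit via the in-tree Lyapunov-equation machinery
HarmonicChainNESS/HarmonicChainCovariance and BernardinOlla2011 Thm 3): compute 1/D_N(ε) − 1/D_N(0)
in closed form and confirm it is ≤ Cε uniformly in N (expected: r_N(0) = O(1/N), r_N(ε) ≈ cε); if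
locality already fails THERE the mechanism is dead. (2) Numerics (kit, NEMD or the deterministic
linear-response solve at small N): pinnedChain(1,1,1,1), T = 1, N ∈ {16, 32, 64, 128}, ε ∈ {0, 0.05,
0.1, 0.2}: (1/D_N(ε) − 1/D_N(0))/ε should be N-independent to 10 %, and κ_ε should DEcrease in ε (if
κ_ε grows as ε ↓ 0 beyond the ε = 0 value, VanishingNoiseBound is in danger). (3) Lookup: any
printed flip-non-invariant local conserved quantity of the quartic pinned FPU-β chain (none known;
the integrability-sieve / no-hidden-charges cards track this) kills VanishingNoiseBound via Mazur.
Not run in this planning session (no kit in plancard mode).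

NUMBERS. BernardinOlla2011 Prop 4: κ_ε(T) ≤ Var_T(V′(r))/(4εT) for the flip-noisy chain (their γ =
our ε) — the O(1/ε) line that OneNoiseWitness must beat once; harmonic + flips: κ_ε = a/(2ε) exactly
(BernardinOlla2011 §6, V = a r²/2). Low-temperature scaling of the conjunct's chain
(LowTemperatureWeakAnharmonicity): κ(T) of pinnedChain is expected ~ (lam T)^{−2}-large as T → 0, so
w, K, ε₁ must degrade as T → 0 (no uniformity claimed).

DEFINITION REQUESTS. (filed after open) notion OscillatorChain.flipGenerator /
OscillatorChain.IsFlipSteadyState / OscillatorChain.FlipFouriersLawFor — the Bernardin–Olla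
velocity-flip perturbation L + εS of an OscillatorChain between Langevin baths and its weak steady
states (topic Literature/MathematicalPhysics/KineticTheory, beside FouriersLaw.lean;
BernardinOlla2011 §2.1). Not blocking: the three cruxes inline the predicate (bound once as S); when
the definition lands a tenure pass may restate them over it (same normal form). Cite facts that
would serve provers of VanishingNoiseBound/NoisyFourier later (need an infinite-volume noisy
dynamics first, hence not filed now): BernardinOlla2011 Thm 2 (GK limit exists with flips), Prop 4
(upper bound), Thm 3 (harmonic Fourier law with flips).

Novelty: Searches (2026-08-15, this session): `lit search --hybrid "vanishing noise limit thermal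
conductivity anharmonic chain velocity flip Green-Kubo uniform bound"` (12 docs: arXiv:2310.13338 +
textbooks, nothing on a noise→0 transfer); `lit search "thermal conductivity anharmonic chain
vanishing noise limit velocity flip" --source crossref` (15: doi:10.1080/10236190903095283 Bernardin
2011 fixed-noise bounds, doi:10.1088/0951-7715/26/3/837 Huveneers 2013 disordered weak-coupling
fall-off, rest off-topic; openalex budget exhausted); `lit galaxy search "conductivity in the limit
of vanishing noise" --star all` (0 rows; panama queue timeout); `lit frontier AtomisticToContinuum
--since 2020` (30 rows; nearest arXiv:2310.13338 CanestrariLiveraniOlla2026, heat equation with an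
external chaotic bulk force — a different regularisation, no ε → 0); `lit read arXiv:1105.0493`
pp.2–4, 10–13 (model §2.1, Prop 1, Thm 2, Prop 4, p.3 'not able to prove [J_s ∝ 1/n]'); plus the
card's reads (doi:10.1007/s00220-014-2206-7 p.3) and the refuter audit of the card (2026-08-15:
BHLLO2015, BernardinOlla2011, BernardinHuveneers2013, DeRoeckHuveneers2015, HairerMajda2009, Soto
2016 §8.6.5 (8.51), OllaSasada2012, KomorowskiLandimOlla2012).
Nearest prior art found: BernardinHuveneersLebowitzLiveraniOlla2015 (doi:10.1007/s00220-014-2206-7)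
§1 — poses noise → 0 for the Green–Kubo conductivity and treats it by FORMAL expansions in the
coupling at fixed noise; Bernardin2014 (arXiv:1407.7023) §2.1.3 — lim sup_{γ→  [refs: 10.1080/10236190903095283, 10.1088/0951-7715/26/3/837, 10.1007/s00220-014-2206-7, 2310.13338, 1105.0493, 1407.7023, doi:10.1080/10236190903095283, doi:10.1088/0951-7715/26/3/837, doi:10.1007/s00220-014-2206-7, CanestrariLiveraniOlla2026, BernardinOlla2011, BernardinHuveneers2013, DeRoeckHuveneers2015, HairerMajda2009, OllaSasada2012, BernardinHuveneersLebowitzLiveraniOlla2015, Bernardin2014]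

Barriers (technique_class: noise-homotopy, vanishing-noise transfer, KLO-variational): - technique_class: noise-homotopy, vanishing-noise transfer, KLO-variational
- Literature.Barriers.AtomisticToContinuum.HasBoundedResponse: its recorded evasion (a) 'add bulk
stochasticity' is exactly X3, and the entry records that (a) 'is not the deterministic
boundary-driven chain'; this route's X1 is the missing bridge. It does NOT make the N-uniform
content disappear: X1 is an N-uniform statement (but about a LOCAL response to one scatterer,
holding even in the ballistic corner, not a mixing constant) and X2 + X1 imply HasBoundedResponse
(pinnedChain); the bet is that ε-uniform control of NOISY conductivities (variational,
infinite-volume, reversible-plus-bounded-antisymmetric structure) is more tractable than N-uniform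
control of the deterministic NESS.
- Literature.Barriers.AtomisticToContinuum.MacroErgodicityBarrier: hydrodynamic/non-gradient
machinery is invoked only inside X3 at FIXED ε > 0, where the flip Dirichlet form is non-degenerate
in all momenta (the entry's evasion (a)); the audit's caveat that printed macro-ergodicity theorems
need bounded U″, V″ (theorem pinnedChain_outside_FFL_scope of MacroErgodicityHypothesis.lean) is
carried as NoisyFourier's why-might-fail; at ε = 0 nothing hydrodynamic is used.
- Literature.Barriers.AtomisticToContinuum.BeckerMenegaki2022_gapClosing: no N-uniform relaxation
rate of the deterministic or boundary-damped chain is used anywhere; fixed-N smoothness in ε (plan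
(b)) needs no uniformity, and the N-uniform object is a resisti

History (route lifecycle, newest last):
- 2026-08-15T13:44:58Z · CLOSED retired — not-a-thesis: assembly does not conclude the sub-problem Statement (operator:999:1257524)

sub-problem: FouriersLaw · status: closed(retired) · opened planner-plancard-AtomisticToContinuum-Fourier-11dc88bb-0 2026-08-15T11:11:34Z · rev 0 · ledger route-AtomisticToContinuum-NoiseHomotopyTransfer
GENERATED by the gate from the ledger (D-0016/17). Provers cite these decls: `theorem foo : Summit.AtomisticToContinuum.FouriersLaw.Theses.NoiseHomotopyTransfer.<Decl> := …` in Summits/AtomisticToContinuum/FouriersLaw/Theorems/<Name>.lean.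
-/

namespace Summit.AtomisticToContinuum.FouriersLaw.Theses.NoiseHomotopyTransfer

open scoped BigOperators Topology Manifold Classical MeasureTheory ProbabilityTheory Matrix InnerProductSpace ComplexConjugate ContinuousMap
open Filter Set Function TopologicalSpace MeasureTheory

attribute [summit_statement] _root_.FouriersLaw

/-- item stmt-AtomisticToContinuum-3112 · crux · rank 2 · closed · moot by None · by planner
why it might fail: N-uniform equicontinuity at ε=0 carries the 'limit exists' half of Fourier's law: false if D_N(0) oscillates in N while each D_N(ε) converges; the sitewise response is a space-time NESS correlation with no N-uniform bound in print (breathers, near-integrable low-T phonons); false if localised.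
sources: BernardinOlla2011 (arXiv:1105.0493) §2.1 and Thm 3, BernardinHuveneersLebowitzLiveraniOlla2015 (doi:10.1007/s00220-014-2206-7) §1, HairerMajda2009 (arXiv:0909.4313) Thm 2.3, BernardinHuveneers2013, Spohn2014 (arXiv:1305.6412) §1-2 (current tails by mode coupling), LepriLiviPoliti2003 §5-6
[crux] NOISE LOCALITY (card noise-homotopy-russo-transfer item 2, filed in modulus form). Noisy
chain := pinnedChain ω₂ lam β γ between the same Langevin baths PLUS independent velocity flips p_i
↦ −p_i at every site at rate ε (generator L + εS, S f = Σ_i (f∘Θ_i − f), BernardinOlla2011 §2.1);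
weak noisy steady state := probability measure with ∫ (L f + ε S f) dμ = 0 for f ∈ C_c^∞ and
integrable bond currents (the flips carry no energy current, so bondCurrent/totalCurrent are the
deterministic ones; at ε = 0 this is IsSteadyState verbatim). In every statement this predicate is
bound once as S with a defining equation (∀ S, S = (fun ε N T_L T_R μ ↦ …) → …). CLAIM: for all
parameters > 0 and T > 0 there is a modulus w with w(ε) → 0 as ε ↓ 0, UNIFORM IN N, such that for
every N, every ε ∈ (0,1], the unique deterministic steady-state family μ⁰ and the unique noisy
family μ^ε at this N, and their response coefficients D⁰ = lim_{δ→0}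
totalCurrent(μ⁰_{T+δ/2,T−δ/2})/δ, D^ε (same for μ^ε): |D⁰ − D^ε| ≤ w(ε)·|D⁰|·|D^ε| — division-free
form of |1/D_N(ε) − 1/D_N(0)| ≤ w(ε) for the bond resistivities r_N = 1/D_N. Expected proof output:
w(ε) = C(T)·ε from a Russo-type derivative formula ∂_ε r_N = -/
@[route_item "route-AtomisticToContinuum-NoiseHomotopyTransfer"]
def NoiseLocality : Prop :=
  ∀ ω₂ lam β γ : ℝ, 0 < ω₂ → 0 < lam → 0 < β → 0 < γ → ∀ S : ℝ → (N : ℕ) → ℝ → ℝ → MeasureTheory.Measure (Literature.MathematicalPhysics.KineticTheory.HeatConduction.PhaseSpace N) → Prop, S = (fun (ε : ℝ) (N : ℕ) (T_L T_R : ℝ) (μ : MeasureTheory.Measure (Literature.MathematicalPhysics.KineticTheory.HeatConduction.PhaseSpace N)) => MeasureTheory.IsProbabilityMeasure μ ∧ (∀ f : Literature.MathematicalPhysics.KineticTheory.HeatConduction.PhaseSpace N → ℝ, ContDiff ℝ ((⊤ : ℕ∞) : WithTop ℕ∞) f → HasCompactSupport f → MeasureTheory.integral μ (fun x => (Literature.MathematicalPhysics.KineticTheory.HeatConduction.pinnedChain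 ω₂ lam β γ).generator N T_L T_R f x + ε * ∑ i : Fin N, (f (x.1, Function.update x.2 i (-x.2 i)) - f x)) = 0) ∧ ∀ i : Fin N, MeasureTheory.Integrable ((Literature.MathematicalPhysics.KineticTheory.HeatConduction.pinnedChain ω₂ lam β γ).bondCurrent N i) μ) → ∀ T : ℝ, 0 < T → ∃ w : ℝ → ℝ, Filter.Tendsto w (nhdsWithin 0 (Set.Ioi 0)) (nhds 0) ∧ ∀ (N : ℕ) (ε : ℝ), 0 < ε → ε ≤ 1 → ∀ μ0 με : ℝ → ℝ → MeasureTheory.Measure (Literature.MathematicalPhysics.KineticTheory.HeatConduction.PhaseSpace N), (∀ T_L T_R : ℝ, 0 < T_L → 0 < T_R → (Literature.MathematicalPhysics.KineticTheory.HeatConduction.pinnedChain ω₂ lam β γ).IsSteadyState N T_L T_R (μ0 T_L T_R) ∧ ∀ ν : MeasureTheory.Measure (Literature.MathematicalPhysics.KineticTheory.HeatConduction.PhaseSpace N), (Literature.MathematicalPhysics.KineticTheory.HeatConduction.pinnedChain ω₂ lam β γ).IsSteadyState N T_L T_R ν → ν = μ0 T_L T_R) → (∀ T_L T_R : ℝ,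 0 < T_L → 0 < T_R → S ε N T_L T_R (με T_L T_R) ∧ ∀ ν : MeasureTheory.Measure (Literature.MathematicalPhysics.KineticTheory.HeatConduction.PhaseSpace N), S ε N T_L T_R ν → ν = με T_L T_R) → ∀ D0 Dε : ℝ, Filter.Tendsto (fun δ : ℝ => (Literature.MathematicalPhysics.KineticTheory.HeatConduction.pinnedChain ω₂ lam β γ).totalCurrent (μ0 (T + δ / 2) (T - δ / 2)) / δ) (nhdsWithin 0 {(0 : ℝ)}ᶜ) (nhds D0) → Filter.Tendsto (fun δ : ℝ => (Literature.MathematicalPhysics.KineticTheory.HeatConduction.pinnedChain ω₂ lam β γ).totalCurrent (με (T + δ / 2) (T - δ / 2)) / δ) (nhdsWithin 0 {(0 : ℝ)}ᶜ) (nhds Dε) → |D0 - Dε| ≤ w ε * |D0| * |Dε|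

/-- item stmt-AtomisticToContinuum-3113 · crux · rank 3 · closed · moot by None · by planner
why it might fail: It is ε-uniform control of the noise-regularised conductivity as noise→0 (BHLLO2015's open question): every printed variational bound is O(1/ε) (BO2011 Prop 4); beating 1/ε needs an approximate deterministic corrector, possibly GreenKubo-hard; false if pinnedChain is anomalous or has a hidden charge
sources: BernardinOlla2011 (arXiv:1105.0493) Thm 2 and Prop 4 eq. (var), BernardinHuveneersLebowitzLiveraniOlla2015 §1, Bernardin2014 (arXiv:1407.7023) §2.1.3, KipnisLandim1999 (variational formulas), BonettoLebowitzReyBellet2000 §6.3, decl Literature.Barriers.AtomisticToContinuum.HasBoundedResponse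
[crux] VANISHING-NOISE BOUND (card item 4 'StrictNoisyBound' in closed form; S = the flip-noisy
steady-state predicate of NoiseLocality). CLAIM: for all parameters > 0 and T > 0 there are K and ε₁
> 0 such that for every ε ∈ (0, ε₁], the unique noisy steady-state family at rate ε, every sequence
D_N(ε) of its response coefficients at T and every limit k = lim_N D_N(ε): k ≤ K — the noisy
conductivities κ_ε(T) stay bounded as the noise vanishes. This is where κ(0) < ∞ lives: given
NoiseLocality (modulus w) and NoisyFourier one has |r₀ − 1/κ_ε| ≤ w(ε), so VanishingNoiseBound ⇔ r₀
> 0 ⇔ there is ONE ε₀ ∈ (0,1] with 1/κ_{ε₀}(T) > w(ε₀) — the card's 'single strict inequality at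
positive noise'. Operational form once w is explicit (foreseen split): certify κ_{ε₀}(T) < 1/w(ε₀)
at one noise level by the Kipnis–Landim–Olla / Sethuraman inf-variational formula for the NOISY
chain, where the symmetric part εS is a bounded non-degenerate-in-momenta Dirichlet form
(BernardinOlla2011 eq. (var); their Prop 4 takes f = −V(r₁)/2 and gets only κ_ε ≤ Var(V′)/(4εT),
i.e. ON the harmonic line c/ε — one must beat 1/ε once, with a test function that encodes anharmonic
scattering; the Gibbs integrals are 1 -/
@[route_item "route-AtomisticToContinuum-NoiseHomotopyTransfer"]
def VanishingNoiseBound : Prop :=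
  ∀ ω₂ lam β γ : ℝ, 0 < ω₂ → 0 < lam → 0 < β → 0 < γ → ∀ S : ℝ → (N : ℕ) → ℝ → ℝ → MeasureTheory.Measure (Literature.MathematicalPhysics.KineticTheory.HeatConduction.PhaseSpace N) → Prop, S = (fun (ε : ℝ) (N : ℕ) (T_L T_R : ℝ) (μ : MeasureTheory.Measure (Literature.MathematicalPhysics.KineticTheory.HeatConduction.PhaseSpace N)) => MeasureTheory.IsProbabilityMeasure μ ∧ (∀ f : Literature.MathematicalPhysics.KineticTheory.HeatConduction.PhaseSpace N → ℝ, ContDiff ℝ ((⊤ : ℕ∞) : WithTop ℕ∞) f → HasCompactSupport f → MeasureTheory.integral μ (fun x => (Literature.MathematicalPhysics.KineticTheory.HeatConduction.pinnedChain ω₂ lam β γ).generator N T_L T_R f x + ε * ∑ i : Fin N, (f (x.1, Function.update x.2 i (-x.2 i)) - f x)) = 0) ∧ ∀ i : Fin N, MeasureTheory.Integrable ((Literature.MathematicalPhysics.KineticTheory.HeatConduction.pinnedChain ω₂ lam β γ).bondCurrent N i) μ) → ∀ T : ℝ, 0 < T → ∃ K ε₁ : ℝ, 0 < ε₁ ∧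 ∀ ε : ℝ, 0 < ε → ε ≤ ε₁ → ∀ μ : (N : ℕ) → ℝ → ℝ → MeasureTheory.Measure (Literature.MathematicalPhysics.KineticTheory.HeatConduction.PhaseSpace N), (∀ (N : ℕ) (T_L T_R : ℝ), 0 < T_L → 0 < T_R → S ε N T_L T_R (μ N T_L T_R) ∧ ∀ ν : MeasureTheory.Measure (Literature.MathematicalPhysics.KineticTheory.HeatConduction.PhaseSpace N), S ε N T_L T_R ν → ν = μ N T_L T_R) → ∀ (D : ℕ → ℝ) (k : ℝ), (∀ N : ℕ, Filter.Tendsto (fun δ : ℝ => (Literature.MathematicalPhysics.KineticTheory.HeatConduction.pinnedChain ω₂ lam β γ).totalCurrent (μ N (T + δ / 2) (T - δ / 2)) / δ) (nhdsWithin 0 {(0 : ℝ)}ᶜ) (nhds (D N))) → Filter.Tendsto D Filter.atTop (nhds k) → k ≤ K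

/-- item stmt-AtomisticToContinuum-3114 · crux · rank 4 · closed · moot by None · by planner
why it might fail: Even with flips, D_N(ε)→κ_ε for the boundary-driven ANHARMONIC chain is unproved (BO2011 p.3 'not able to prove'); non-gradient/macro-ergodicity theorems need bounded U″,V″ (FFL) and the quartic pinnedChain is outside that scope (pinnedChain_outside_FFL_scope); bath boundary layers.
sources: BernardinOlla2011 (arXiv:1105.0493) Prop 1 / Thm 2 / Thm 3 / p.3, BernardinOlla2005, OllaSasada2012 (doi:10.1007/s00440-012-0469-5), Bernardin2014 (arXiv:1407.7023) Thm 3, CuneoEckmannHairerReyBellet2018 Thm 2.13, decl Literature.Barriers.AtomisticToContinuum.MacroErgodicityBarrier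
[crux] NOISY FOURIER LAW (card item 3; S = the flip-noisy steady-state predicate of NoiseLocality).
CLAIM: for all parameters > 0 and EVERY flip rate ε > 0, OscillatorChain.FouriersLawFor verbatim for
the noisy chain: (i) for all N and T_L, T_R > 0 the weak steady state of L + εS exists and is
unique; (ii) there is κ_ε : ℝ → ℝ with κ_ε(T) > 0 for T > 0 such that for every noisy steady-state
family and every T > 0 the response limits D_N(ε) = lim_{δ→0, δ≠0} totalCurrent(μ_{N,T+δ/2,T−δ/2})/δ
exist for all N and D_N(ε) → κ_ε(T). Print: NESS existence and uniqueness for anharmonic chain +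
flips + Langevin baths (BernardinOlla2011 Prop 1, unpinned with tension; for the pinned chain:
CEHR2018 Lyapunov/Harris machinery plus a bounded jump perturbation, and Echeverría-type
identification of weak solutions of the jump-diffusion Fokker–Planck equation); Green–Kubo limit
exists with flips (BernardinOlla2011 Thm 2) with two-sided bounds (Props 4–8); Fourier's law IN THE
NESS only for the harmonic bulk (BernardinOlla2011 Thm 3; BernardinOlla2005 for the exchange noise);
diffusive hydrodynamic limit for anharmonic + conservative noise by the non-gradient method for
bounded-Hessian potentials (Ol -/
@[route_item "route-AtomisticToContinuum-NoiseHomotopyTransfer"]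
def NoisyFourier : Prop :=
  ∀ ω₂ lam β γ : ℝ, 0 < ω₂ → 0 < lam → 0 < β → 0 < γ → ∀ S : ℝ → (N : ℕ) → ℝ → ℝ → MeasureTheory.Measure (Literature.MathematicalPhysics.KineticTheory.HeatConduction.PhaseSpace N) → Prop, S = (fun (ε : ℝ) (N : ℕ) (T_L T_R : ℝ) (μ : MeasureTheory.Measure (Literature.MathematicalPhysics.KineticTheory.HeatConduction.PhaseSpace N)) => MeasureTheory.IsProbabilityMeasure μ ∧ (∀ f : Literature.MathematicalPhysics.KineticTheory.HeatConduction.PhaseSpace N → ℝ, ContDiff ℝ ((⊤ : ℕ∞) : WithTop ℕ∞) f → HasCompactSupport f → MeasureTheory.integral μ (fun x => (Literature.MathematicalPhysics.KineticTheory.HeatConduction.pinnedChain ω₂ lam β γ).generator N T_L T_R f x + ε * ∑ i : Fin N, (f (x.1, Function.update x.2 i (-x.2 i)) - f x)) = 0) ∧ ∀ i : Fin N, MeasureTheory.Integrable ((Literature.MathematicalPhysics.KineticTheory.HeatConduction.pinnedChain ω₂ lam β γ).bondCurrent N i) μ) → ∀ ε : ℝ, 0 < ε → (∀ (N : ℕ)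 (T_L T_R : ℝ), 0 < T_L → 0 < T_R → ∃ μ : MeasureTheory.Measure (Literature.MathematicalPhysics.KineticTheory.HeatConduction.PhaseSpace N), S ε N T_L T_R μ ∧ ∀ ν : MeasureTheory.Measure (Literature.MathematicalPhysics.KineticTheory.HeatConduction.PhaseSpace N), S ε N T_L T_R ν → ν = μ) ∧ ∃ κ : ℝ → ℝ, (∀ T : ℝ, 0 < T → 0 < κ T) ∧ ∀ μ : (N : ℕ) → ℝ → ℝ → MeasureTheory.Measure (Literature.MathematicalPhysics.KineticTheory.HeatConduction.PhaseSpace N), (∀ (N : ℕ) (T_L T_R : ℝ), 0 < T_L → 0 < T_R → S ε N T_L T_R (μ N T_L T_R)) → ∀ T : ℝ, 0 < T → ∃ D : ℕ → ℝ, (∀ N : ℕ, Filter.Tendsto (fun δ : ℝ => (Literature.MathematicalPhysics.KineticTheory.HeatConduction.pinnedChain ω₂ lam β γ).totalCurrent (μ N (T + δ / 2) (T - δ / 2)) / δ) (nhdsWithin 0 {(0 : ℝ)}ᶜ) (nhds (D N))) ∧ Filter.Tendsto D Filter.atTop (nhds (κ T))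

/-- item stmt-AtomisticToContinuum-0717 · support · rank 9 · closed · proved by Summit.AtomisticToContinuum.FouriersLaw.Theorems.FourierGreenKubo.finiteResponseOfUnique_holds (prover) · by planner
sources: HairerMajda2009 (arXiv:0909.4313), ReyBellet2003 Rem 4.4, CuneoEckmannHairerReyBellet2018
CONDITIONAL FORM OF 0705 (supersedes it as the prover target; refuters pool-5/g3-0: 0705 stand-alone
quantifies over EVERY steady-state family and is false-prone if weak steady states were non-unique):
assuming UNIQUENESS of weak steady states (IsSteadyState class) for pinnedChain at all N, T_L, T_R >
0, the finite-N linear-response limit D_N(T) = lim_{δ→0, δ≠0} totalCurrent(μ_{N,T+δ/2,T−δ/2})/δ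
exists for every T > 0 and N. Content: differentiability at equilibrium of NESS expectations of the
polynomial currents in the bath temperatures (ReyBellet2003 arXiv:math-ph/0303021 Rem 4.4 (51)–(56)
finite-volume Green–Kubo; HairerMajda2009 arXiv:0909.4313 Thm 2.3 framework — their SDE Thm 4.4
Assumption 5 fails here, so verify Assumptions 1–3 via CEHR2018 (2.5)/Carmona2007 Thm 1.1(iv)
weighted spectral gap). N = 0, 1: totalCurrent ≡ 0, D = 0. Together with 0706 gives 0705. -/
@[route_item "route-AtomisticToContinuum-NoiseHomotopyTransfer"]
def FiniteResponseOfUnique : Prop :=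
  ∀ ω₂ lam β γ : ℝ, 0 < ω₂ → 0 < lam → 0 < β → 0 < γ → (∀ (N : ℕ) (T_L T_R : ℝ), 0 < T_L → 0 < T_R → ∀ μ ν : MeasureTheory.Measure (Literature.MathematicalPhysics.KineticTheory.HeatConduction.PhaseSpace N), (Literature.MathematicalPhysics.KineticTheory.HeatConduction.pinnedChain ω₂ lam β γ).IsSteadyState N T_L T_R μ → (Literature.MathematicalPhysics.KineticTheory.HeatConduction.pinnedChain ω₂ lam β γ).IsSteadyState N T_L T_R ν → μ = ν) → ∀ μ : (N : ℕ) → ℝ → ℝ → MeasureTheory.Measure (Literature.MathematicalPhysics.KineticTheory.HeatConduction.PhaseSpace N), (∀ (N : ℕ) (T_L T_R : ℝ), 0 < T_L → 0 < T_R → (Literature.MathematicalPhysics.KineticTheory.HeatConduction.pinnedChain ω₂ lam β γ).IsSteadyState N T_L T_R (μ N T_L T_R)) → ∀ T : ℝ, 0 < T → ∀ N : ℕ, ∃ D : ℝ, Filter.Tendsto (fun δ : ℝ => (Literature.MathematicalPhysics.KineticTheory.HeatConduction.pinnedChain ω₂ lam β γ).totalCurrent (μ N (T + δ / 2) (T -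 δ / 2)) / δ) (nhdsWithin 0 {(0 : ℝ)}ᶜ) (nhds D)

/-- `FiniteResponseOfUnique` holds: proved by `Summit.AtomisticToContinuum.FouriersLaw.Theorems.FourierGreenKubo.finiteResponseOfUnique_holds`. -/
theorem FiniteResponseOfUnique_holds : FiniteResponseOfUnique := _root_.Summit.AtomisticToContinuum.FouriersLaw.Theorems.FourierGreenKubo.finiteResponseOfUnique_holds

/-- item stmt-AtomisticToContinuum-0741 · support · rank 9 · closed · proved by Summit.AtomisticToContinuum.FouriersLaw.Theorems.nessUnique_proof (prover) · by planner
sources: CuneoEckmannHairerReyBellet2018 Thm 2.13, decl Literature.MathematicalPhysics.KineticTheory.HeatConduction.CuneoEckmannHairerReyBellet2018_pinnedChain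
[crux] UNIQUENESS OF THE WEAK STEADY STATE (the half of stmt-0706 not covered by the landed fact
Literature.MathematicalPhysics.KineticTheory.HeatConduction.CuneoEckmannHairerReyBellet2018_pinnedChain,
p3544): for pinnedChain ω₂ lam β γ (all > 0), every N and T_L, T_R > 0, any two measures in the weak
Fokker–Planck class IsSteadyState (probability, ∫ L f dμ = 0 for f ∈ C_c^∞, bond currents
integrable) coincide. Print: uniqueness of the INVARIANT MEASURE of the Langevin semigroup
(CuneoEckmannHairerReyBellet2018 Thm 2.13(1): C1, C2, CA; Carmona2007 Thm 1.1(iii)); the item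
additionally needs 'weak stationary probability solution of L*μ = 0 ⇒ P_t-invariant' for this
hypoelliptic L with cubic drift (Echeverría 1982 well-posed martingale problem on C_c^∞ +
non-explosion via e^{θH}; Bogachev–Krylov–Röckner–Shaposhnikov 2015 Ch. 5 is non-degenerate only) —
the FP-identification lemma is the formal crux. N = 0: PhaseSpace 0 is a point (unique probability
measure); N = 1: both baths on site 0, OU at temperature (T_L+T_R)/2. This is exactly the hypothesis
of FiniteResponse and ThermodynamicLimit and, with the fact, gives clause (i) of FouriersLawFor. -/
@[route_item "route-AtomisticToContinuum-NoiseHomotopyTransfer"]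
def NessUnique : Prop :=
  ∀ ω₂ lam β γ : ℝ, 0 < ω₂ → 0 < lam → 0 < β → 0 < γ → ∀ (N : ℕ) (T_L T_R : ℝ), 0 < T_L → 0 < T_R → ∀ μ ν : MeasureTheory.Measure (Literature.MathematicalPhysics.KineticTheory.HeatConduction.PhaseSpace N), (Literature.MathematicalPhysics.KineticTheory.HeatConduction.pinnedChain ω₂ lam β γ).IsSteadyState N T_L T_R μ → (Literature.MathematicalPhysics.KineticTheory.HeatConduction.pinnedChain ω₂ lam β γ).IsSteadyState N T_L T_R ν → μ = ν

/-- `NessUnique` holds: proved by `Summit.AtomisticToContinuum.FouriersLaw.Theorems.nessUnique_proof`. -/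
theorem NessUnique_holds : NessUnique := _root_.Summit.AtomisticToContinuum.FouriersLaw.Theorems.nessUnique_proof

/-- item stmt-AtomisticToContinuum-3115 · assembly · rank 1 · closed · moot by None · by planner
sources: decl Literature.HeatConduction.fouriersLaw_of_steadyState_and_linearResponse, decl Literature.MathematicalPhysics.KineticTheory.HeatConduction.CuneoEckmannHairerReyBellet2018_pinnedChain_holds, BonettoLebowitzReyBellet2000 §5.3 (33)
[assembly] (landed fact CuneoEckmannHairerReyBellet2018_pinnedChain) → NessUnique →
FiniteResponseOfUnique → NoiseLocality → VanishingNoiseBound → NoisyFourier → FouriersLaw, the route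
decls referenced by their fully qualified names (rendered above this item). GLUE (real analysis +
bookkeeping, ≈ 100 Lean lines): fix parameters; clause (i) from the fact (N ≥ 1) /
OscillatorChain.isSteadyState_zero (N = 0) + NessUnique. For T > 0 let μ⁰ be the unique family
(Classical.choose; arbitrary at non-positive temperatures) and D⁰_N its response
(FiniteResponseOfUnique); any other steady family agrees with μ⁰ at positive temperatures, and T ±
δ/2 > 0 for |δ| < 2T, so its δ-limits exist and coincide. Instantiate the three cruxes with S := the
noisy predicate (rfl). NoisyFourier(ε): unique noisy family μ^ε, responses D^ε_N → κ_ε(T) > 0;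
VanishingNoiseBound: κ_ε(T) ≤ K for ε ≤ ε₁; NoiseLocality: |D⁰_N − D^ε_N| ≤ w(ε)|D⁰_N||D^ε_N|, w → 0
at 0⁺. For ε ≤ min(ε₁,1) and N ≥ N_ε: D^ε_N > κ_ε/2 > 0, hence D⁰_N ≠ 0 (else the bound forces D^ε_N
= 0), and r_N := 1/D⁰_N, s_N := 1/D^ε_N satisfy |r_N − s_N| ≤ |w(ε)|, s_N → 1/κ_ε ≥ 1/K. So limsup_N
r_N − liminf_N r_N ≤ 2|w(ε)| → 0: r_N → r₀ with |r₀ − 1/κ_ε| -/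
@[route_item "route-AtomisticToContinuum-NoiseHomotopyTransfer"]
def Assembly : Prop :=
  Literature.MathematicalPhysics.KineticTheory.HeatConduction.CuneoEckmannHairerReyBellet2018_pinnedChain → Summit.AtomisticToContinuum.FouriersLaw.Theses.NoiseHomotopyTransfer.NessUnique → Summit.AtomisticToContinuum.FouriersLaw.Theses.NoiseHomotopyTransfer.FiniteResponseOfUnique → Summit.AtomisticToContinuum.FouriersLaw.Theses.NoiseHomotopyTransfer.NoiseLocality → Summit.AtomisticToContinuum.FouriersLaw.Theses.NoiseHomotopyTransfer.VanishingNoiseBound → Summit.AtomisticToContinuum.FouriersLaw.Theses.NoiseHomotopyTransfer.NoisyFourier → Literature.MathematicalPhysics.KineticTheory.HeatConduction.FouriersLaw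

end Summit.AtomisticToContinuum.FouriersLaw.Theses.NoiseHomotopyTransfer
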